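import Literature.AlgebraicGeometry.HodgeTheory.HodgeFiltration
import HarnessLib

/-!
# The Hodge filtration of a Hodge model: `F¹Hᵏ = Hᵏ ↔ H^{0,k} = 0`, and independence of the model

Family `hodge`, layer `Literature/AlgebraicGeometry/HodgeTheory`. Companion to `HodgeFiltration`
(`HodgeModel.hodgeFiltration A k r = Fʳ Hᵏ(X^an; ℂ) = ⨆_{p ≥ r, p+q=k} H^{p,q}` and the
`∃`-over-models predicate `IsInHodgeFiltration n X k r c`). Two things, both needed to split the
named fact `Voisin2003_hypersurface_hodgeFiltration_ne_top` (file `HypersurfaceHodgeFiltration`,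
Voisin II Rem. 6.26: `Fᵖ Hᵐ(Y) ≠ Hᵐ(Y)` for smooth hypersurfaces of degree `d ≥ m + 2`) into its
printed ingredients:

* **Proved.** In a Hodge model `A` the Hodge decomposition (field `isInternal_hodgePQ`: the
  pieces `H^{p,q}`, `p + q = k`, are independent and span) gives
  `F¹ Hᵏ = Hᵏ ↔ H^{0,k} = 0` (`HodgeModel.hodgeFiltration_one_eq_top_iff`), hence
  `H^{0,k} ≠ 0 → Fʳ Hᵏ ≠ Hᵏ` for every `r ≥ 1` (`HodgeModel.hodgeFiltration_ne_top_of_hodgePQ_zero_ne_bot`);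
  this is the step "`Fᵖ𝓗^{n-1} ≠ 𝓗^{n-1}` … i.e. its component of type `(0, n-1)` is non-zero"
  of Voisin II, Rem. 6.26. Also the surjectivity of the pull-back `Hᵏ(X(ℂ); ℂ) → Hᵏ(X^an; ℂ)`
  and its injectivity (`HodgeModel.pullback_surjective`, `HodgeModel.pullback_injective`; the
  comparison map is a homeomorphism).
* **Named fact (D-0014)** `hodgePQ_independent_of_hodgeModel`: for a smooth projective `X`,
  whether the pull-back of a class `c ∈ Hᵏ(X(ℂ); ℂ)` lies in the piece `H^{p,q}` does not depend on
  the Hodge model; PROVED from it: the same for `Fʳ` (`.mem_hodgeFiltration`, decomposing along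
  the bijective pull-backs `HodgeModel.pullback_surjective/injective`). This is the bridge between
  the tree's encoding (`IsOfHodgeType`, `IsInHodgeFiltration` quantify `∃` over Hodge models; a
  statement "some class is in NO model's `Fʳ`" quantifies `∀`) and THE Hodge decomposition /
  filtration of the printed sources; it is the assertion of the module docstring of
  `RationalHodgeClasses` ("all Hodge models of a smooth projective `X` give the same subspace"),
  given a name so that its uses are tracked. Printed ingredients: two analytifications differ by a
  unique biholomorphism over `X(ℂ)` [Serre, GAGA §2] (in the tree:
  `Literature.NumberTheory.Transcendental.IsAnalytification.unique`, and the proved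
  `mdifferentiable_comp_map_holds`); the pull-back of a closed `(p,q)`-form by a holomorphic map is a
  closed `(p,q)`-form, so biholomorphisms identify the `H^{p,q}` (Voisin I, Prop. 6.11 and §7.3.2:
  "`φ^*` is a morphism of Hodge structures"); and two natural `ℂ`-linear comparison families
  `H^k_dR(–; ℂ) ≃ Hᵏ(–; ℂ)` on manifolds charted on `E` differ by a natural automorphism of
  `Hᵏ(–; ℂ)`, which is a scalar on `Hᵏ` of a compact orientable `M` because its rational homology
  is spanned by fundamental classes of closed oriented submanifolds (Thom, Comment. Math. Helv. 28 (1954), Thm. II.29 /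
  Cor. II.30, key `ThomCMH1954`; test on `V × ℝ^{2n-k}` and compare the scalars of different `V` through degree-one
  pinch maps of connected sums) — a scalar does not move `e(H^{p,q})`.
  With the fact, `IsInHodgeFiltration n X k r c ↔ A.pullback k c ∈ A.hodgeFiltration k r` for ANY
  model `A`, and `(∃ c, ¬ IsInHodgeFiltration n X k r c) ↔ A.hodgeFiltration k r ≠ ⊤`.

Not here: the discharge of the named fact (needs the rigidity theorem for natural de Rham
families, not in the tree), and anything specific to hypersurfaces (file
`HypersurfaceHodgeFiltration`).

## References

* C. Voisin, *Hodge Theory and Complex Algebraic Geometry I* (2002), Prop. 6.11, Cor. 6.14,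
  §7.1.1 (the Hodge filtration), Prop. 7.5, §7.3.2 (functoriality).
* C. Voisin, *Hodge Theory and Complex Algebraic Geometry II* (2003), Rem. 6.26.
* J.-P. Serre, *Géométrie algébrique et géométrie analytique*, Ann. Inst. Fourier 6 (1956), §2.
* R. Thom, *Quelques propriétés globales des variétés différentiables*, Comment. Math. Helv. 28
  (1954), Thm. II.29, Cor. II.30.
* A. Hatcher, *Algebraic Topology* (2002), §3.1.
-/

noncomputable section

open CategoryTheory

namespace Literature.AlgebraicGeometry.HodgeTheory

section HodgeTheory

variable {n : ℕ} {X : Motives.SchemeOver ℂ}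

/-! ### `F¹ Hᵏ = Hᵏ` versus `H^{0,k} = 0` in a Hodge model -/

/-- In a Hodge model, if `Fʳ Hᵏ = Hᵏ` for some `r ≥ 1` then `H^{0,k} = 0`: the pieces `H^{p,q}`,
`p + q = k`, are independent (Hodge decomposition, field `isInternal_hodgePQ`), and `Fʳ`, `r ≥ 1`,
is spanned by pieces other than `H^{0,k}`. (Voisin I, Cor. 6.14: a class of two different types is
zero.) [cite: VoisinHodgeI2002, Cor. 6.14 and §7.1.1] -/
theorem HodgeModel.hodgePQ_zero_eq_bot_of_hodgeFiltration_eq_top (A : HodgeModel n X) {k r : ℕ}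
    (hr : 1 ≤ r) (h : A.hodgeFiltration k r = ⊤) : A.hodgePQ k 0 k = ⊥ := by
  -- the de Rham side: pieces `T pq`, independent by the Hodge decomposition of the model
  set e := A.deRham A.carrier k with he
  set T : ↥(Finset.antidiagonal k) →
      Submodule ℂ (Literature.NumberTheory.Transcendental.complexDeRhamCohomology A.model A.carrier k) :=
    fun pq ↦ Literature.NumberTheory.Transcendental.hodgePQ A.model A.carrier k pq.1.1 pq.1.2 with hT
  have hind : iSupIndep T := (A.isInternal_hodgePQ k).submodule_iSupIndep
  let i₀ : ↥(Finset.antidiagonal k) := ⟨(0, k), Finset.mem_antidiagonal.2 (zero_add k)⟩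
  -- `Fʳ ≤ e (⨆_{j ≠ i₀} T j)` for `r ≥ 1`
  have hF : A.hodgeFiltration k r ≤ (⨆ (j) (_ : j ≠ i₀), T j).map e.toLinearMap := by
    refine iSup_le fun p ↦ iSup_le fun q ↦ iSup_le fun hpq ↦ iSup_le fun hrp ↦ ?_
    refine Submodule.map_mono ?_
    have hj : (⟨(p, q), Finset.mem_antidiagonal.2 hpq⟩ : ↥(Finset.antidiagonal k)) ≠ i₀ := by
      intro hji
      have hp0 : p = 0 := congrArg (fun j : ↥(Finset.antidiagonal k) ↦ j.1.1) hji
      omega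
    exact le_iSup₂_of_le (f := fun (j : ↥(Finset.antidiagonal k)) (_ : j ≠ i₀) ↦ T j) _ hj le_rfl
  -- hence `T i₀ ≤ ⨆_{j ≠ i₀} T j`, so `T i₀ = ⊥` by independence
  have hT0 : T i₀ = ⊥ := by
    refine (Submodule.eq_bot_iff _).2 fun x hx ↦ ?_
    have hex : e x ∈ A.hodgeFiltration k r := by rw [h]; exact Submodule.mem_top
    have hx' : x ∈ ⨆ (j) (_ : j ≠ i₀), T j := by
      have h1 := hF hex
      rw [Submodule.mem_map] at h1
      obtain ⟨y, hy, hyx⟩ := h1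
      have hxy : y = x := e.injective hyx
      exact hxy ▸ hy
    exact (Submodule.disjoint_def.1 (hind i₀)) x hx hx'
  change (T i₀).map e.toLinearMap = ⊥
  rw [hT0, Submodule.map_bot]

/-- Conversely, if `H^{0,k} = 0` then `F¹ Hᵏ = Hᵏ`: `Hᵏ = F⁰ = ⨆_{p+q=k} H^{p,q}`
(`HodgeModel.hodgeFiltration_zero`) and every piece but `H^{0,k}` lies in `F¹`.
[cite: VoisinHodgeI2002, §7.1.1] -/
theorem HodgeModel.hodgeFiltration_one_eq_top_of_hodgePQ_zero_eq_bot (A : HodgeModel n X) {k : ℕ}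
    (h : A.hodgePQ k 0 k = ⊥) : A.hodgeFiltration k 1 = ⊤ := by
  rw [eq_top_iff, ← A.hodgeFiltration_zero k]
  refine iSup_le fun p ↦ iSup_le fun q ↦ iSup_le fun hpq ↦ iSup_le fun _ ↦ ?_
  rcases Nat.eq_zero_or_pos p with rfl | hp
  · obtain rfl : q = k := by simpa using hpq
    rw [h]
    exact bot_le
  · exact A.hodgePQ_le_hodgeFiltration hpq hp

/-- **`F¹ Hᵏ = Hᵏ ↔ H^{0,k} = 0`** in a Hodge model (equivalently `F¹ ≠ Hᵏ ↔ H^{0,k} ≠ 0`; cf. the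
phrase "of maximal Hodge level, i.e. … its component of type `(0, n-1)` is non-zero" in Voisin II,
Rem. 6.26). From the Hodge decomposition of the model and `Fʳ = ⨁_{p ≥ r} H^{p,k-p}`.
[cite: VoisinHodgeI2002, §7.1.1] -/
theorem HodgeModel.hodgeFiltration_one_eq_top_iff (A : HodgeModel n X) (k : ℕ) :
    A.hodgeFiltration k 1 = ⊤ ↔ A.hodgePQ k 0 k = ⊥ :=
  ⟨A.hodgePQ_zero_eq_bot_of_hodgeFiltration_eq_top le_rfl,
    A.hodgeFiltration_one_eq_top_of_hodgePQ_zero_eq_bot⟩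

/-- If `H^{0,k} ≠ 0` then `Fʳ Hᵏ ≠ Hᵏ` for every `r ≥ 1` (`Fʳ ⊆ F¹`; cf. Voisin II, Rem. 6.26).
[cite: VoisinHodgeI2002, §7.1.1] -/
theorem HodgeModel.hodgeFiltration_ne_top_of_hodgePQ_zero_ne_bot (A : HodgeModel n X) {k r : ℕ}
    (hr : 1 ≤ r) (h : A.hodgePQ k 0 k ≠ ⊥) : A.hodgeFiltration k r ≠ ⊤ :=
  fun hr' ↦ h (A.hodgePQ_zero_eq_bot_of_hodgeFiltration_eq_top hr hr')

/-- `H^{0,k}` of the model vanishes iff the de Rham piece `H^{0,k} ⊆ H^k_dR(X^an; ℂ)` (span of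
the classes of closed `(0,k)`-forms) vanishes: the comparison `e` is an isomorphism.
[cite: VoisinHodgeI2002, §6.1.3] -/
theorem HodgeModel.hodgePQ_eq_bot_iff (A : HodgeModel n X) (k p q : ℕ) :
    A.hodgePQ k p q = ⊥ ↔ Literature.NumberTheory.Transcendental.hodgePQ A.model A.carrier k p q = ⊥ := by
  change (Literature.NumberTheory.Transcendental.hodgePQ A.model A.carrier k p q).map
      (A.deRham A.carrier k).toLinearMap = ⊥ ↔ _
  exact Submodule.map_eq_bot_iff

/-! ### Surjectivity of the pull-back to the model -/

/-- The pull-back `Hᵏ(X(ℂ); ℂ) → Hᵏ(X^an; ℂ)` of a Hodge model is surjective (indeed bijective: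
the comparison map is a homeomorphism, `singularCohomology.mapIso`; cf.
`HodgeModel.pullback_bijective` in `Literature/Barriers/HodgeConjecture/DecompositionOfTheDiagonal`,
not imported here to keep the barrier catalogue downstream). [cite: HatcherAT2002, §3.1] -/
theorem HodgeModel.pullback_surjective (A : HodgeModel n X) (k : ℕ) :
    Function.Surjective (A.pullback k) := by
  have hb := (Literature.AlgebraicTopology.SingularHomology.singularCohomology.mapIso (R := ℂ) (M := ℂ)
    A.isAnalytification.homeomorph k).toLinearEquiv.surjective
  intro x
  obtain ⟨c, hc⟩ := hb x
  exact ⟨c, hc⟩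

/-- The pull-back `Hᵏ(X(ℂ); ℂ) → Hᵏ(X^an; ℂ)` of a Hodge model is injective (same reason).
[cite: HatcherAT2002, §3.1] -/
theorem HodgeModel.pullback_injective (A : HodgeModel n X) (k : ℕ) :
    Function.Injective (A.pullback k) := by
  have hb := (Literature.AlgebraicTopology.SingularHomology.singularCohomology.mapIso (R := ℂ) (M := ℂ)
    A.isAnalytification.homeomorph k).toLinearEquiv.injective
  intro a b hab
  exact hb hab

/-- Hence `Fʳ Hᵏ(X^an) ≠ Hᵏ(X^an)` iff some class of `Hᵏ(X(ℂ); ℂ)` pulls back outside `Fʳ`.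
[cite: VoisinHodgeI2002, §7.1.1] -/
theorem HodgeModel.hodgeFiltration_ne_top_iff (A : HodgeModel n X) (k r : ℕ) :
    A.hodgeFiltration k r ≠ ⊤ ↔
      ∃ c : Literature.AlgebraicTopology.SingularHomology.singularCohomology ℂ ℂ (Motives.ComplexPoints X) k,
        A.pullback k c ∉ A.hodgeFiltration k r := by
  constructor
  · intro h
    obtain ⟨x, hx⟩ : ∃ x, x ∉ A.hodgeFiltration k r :=
      not_forall.1 fun hall ↦ h (eq_top_iff.2 fun x _ ↦ hall x)
    obtain ⟨c, rfl⟩ := A.pullback_surjective k x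
    exact ⟨c, hx⟩
  · rintro ⟨c, hc⟩ h
    exact hc (h ▸ Submodule.mem_top)

/-! ### Independence of the Hodge model (named fact) -/

/-- **The Hodge decomposition does not depend on the Hodge model** (named fact, D-0014). For a
smooth projective `X` of dimension `n` over `ℂ`, two Hodge models `A`, `A'` of `X` (analytification
+ natural de Rham comparison + Hodge decomposition) and a class `c ∈ Hᵏ(X(ℂ); ℂ)`: if the
pull-back of `c` to `A` lies in the piece `H^{p,q}` of `A` (image under the comparison of the
classes of closed `(p,q)`-forms), then its pull-back to `A'` lies in the piece `H^{p,q}` of `A'`.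
Printed ingredients: `A'.carrier → A.carrier` over `X(ℂ)` is a biholomorphism (uniqueness of the
analytification, Serre; in the tree `IsAnalytification.unique`, cf. the proved
`mdifferentiable_comp_map_holds`); the pull-back of a closed `(p,q)`-form by a holomorphic map is
a closed `(p,q)`-form, so a biholomorphism identifies the `H^{p,q} ⊆ H^k_dR` of the two sides
(Voisin I, §7.3.2: "`φ^*` is a morphism of Hodge structures"; Prop. 6.11: `H^{p,q} = K^{p,q}`, the
classes representable by a closed `(p,q)`-form); and the two natural comparison families differ on
`Hᵏ(A'.carrier; ℂ)` by a natural `ℂ`-linear automorphism of `Hᵏ(–; ℂ)` over manifolds charted on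
the model space, which is a scalar: it is a scalar on `Hᵏ(V × ℝ^{2n-k}; ℂ) ≅ ℂ` for every closed
connected oriented `k`-manifold `V`, the same scalar for all `V` (degree-one pinch maps of
connected sums), hence that scalar on `Hᵏ` of the compact orientable manifold `A'.carrier`, whose
rational homology is spanned by fundamental classes of oriented submanifolds (Thom) — and a
scalar preserves `e(H^{p,q})`. This is the assertion of the module docstring of
`RationalHodgeClasses` ("all Hodge models of a smooth projective `X` give the same subspace
`e(H^{p,q})` pulled back to `X(ℂ)`"), named so that its uses are tracked; it bridges the tree's
`∃`-over-models predicates (`IsOfHodgeType`, `IsInHodgeFiltration`) and THE Hodge decomposition.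
[cite: SerreGAGA1956, §2 (unicité de X^h)] [cite: VoisinHodgeI2002, Prop. 6.11 and §7.3.2]
[cite: ThomCMH1954, Thm. II.29 and Cor. II.30] -/
def hodgePQ_independent_of_hodgeModel : Prop :=
  ∀ (n : ℕ) (X : Motives.SchemeOver ℂ), Motives.IsSmoothProjective n X →
    ∀ (A A' : HodgeModel n X) (k p q : ℕ)
      (c : Literature.AlgebraicTopology.SingularHomology.singularCohomology ℂ ℂ (Motives.ComplexPoints X) k),
      A.pullback k c ∈ A.hodgePQ k p q → A'.pullback k c ∈ A'.hodgePQ k p q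

namespace hodgePQ_independent_of_hodgeModel

variable {k p q r : ℕ}
  {c : Literature.AlgebraicTopology.SingularHomology.singularCohomology ℂ ℂ (Motives.ComplexPoints X) k}

/-- Symmetric form: membership of the pull-back in `H^{p,q}` is the same in any two Hodge models.
[cite: VoisinHodgeI2002, Prop. 6.11 and §7.3.2] -/
theorem mem_hodgePQ_iff (h : hodgePQ_independent_of_hodgeModel) (hX : Motives.IsSmoothProjective n X)
    (A A' : HodgeModel n X) :
    A.pullback k c ∈ A.hodgePQ k p q ↔ A'.pullback k c ∈ A'.hodgePQ k p q :=
  ⟨h n X hX A A' k p q c, h n X hX A' A k p q c⟩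

/-- With the fact, the Hodge type of a class (`IsOfHodgeType`, `∃` over models) may be tested in
ANY Hodge model. [cite: VoisinHodgeI2002, Prop. 6.11] -/
theorem isOfHodgeType_iff (h : hodgePQ_independent_of_hodgeModel) (hX : Motives.IsSmoothProjective n X)
    (A : HodgeModel n X) : IsOfHodgeType n X k p q c ↔ A.pullback k c ∈ A.hodgePQ k p q :=
  ⟨fun ⟨A', hA'⟩ ↦ (mem_hodgePQ_iff h hX A' A).1 hA', fun hA ↦ ⟨A, hA⟩⟩

/-- **The Hodge filtration does not depend on the Hodge model**: if the pull-back of `c` to `A`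
lies in `Fʳ Hᵏ = ⨆_{p ≥ r} H^{p,k-p}` of `A`, then its pull-back to `A'` lies in `Fʳ Hᵏ` of `A'`
(decompose in `A`, transfer each piece, recompose; the pull-backs are bijective).
[cite: VoisinHodgeI2002, §7.1.1 and §7.3.2] -/
theorem mem_hodgeFiltration (h : hodgePQ_independent_of_hodgeModel) (hX : Motives.IsSmoothProjective n X)
    (A A' : HodgeModel n X) (hc : A.pullback k c ∈ A.hodgeFiltration k r) :
    A'.pullback k c ∈ A'.hodgeFiltration k r := by
  -- `S` = classes on `X(ℂ)` whose `A'`-pull-back lies in `Fʳ(A')`; `T` = its image in `Hᵏ(A.carrier)`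
  let S : Submodule ℂ (Literature.AlgebraicTopology.SingularHomology.singularCohomology ℂ ℂ (Motives.ComplexPoints X) k) :=
    (A'.hodgeFiltration k r).comap (A'.pullback k).hom
  let T : Submodule ℂ (Literature.AlgebraicTopology.SingularHomology.singularCohomology ℂ ℂ A.carrier k) :=
    S.map (A.pullback k).hom
  have hF : A.hodgeFiltration k r ≤ T := by
    refine iSup_le fun p ↦ iSup_le fun q ↦ iSup_le fun hpq ↦ iSup_le fun hrp ↦ fun x hx ↦ ?_
    obtain ⟨c₀, rfl⟩ := A.pullback_surjective k x
    exact ⟨c₀, A'.hodgePQ_le_hodgeFiltration hpq hrp (h n X hX A A' k p q c₀ hx), rfl⟩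
  obtain ⟨c₁, hc₁, hc₁c⟩ := hF hc
  obtain rfl : c₁ = c := A.pullback_injective k hc₁c
  exact hc₁

/-- Symmetric form for the Hodge filtration. [cite: VoisinHodgeI2002, §7.1.1 and §7.3.2] -/
theorem mem_hodgeFiltration_iff (h : hodgePQ_independent_of_hodgeModel)
    (hX : Motives.IsSmoothProjective n X) (A A' : HodgeModel n X) :
    A.pullback k c ∈ A.hodgeFiltration k r ↔ A'.pullback k c ∈ A'.hodgeFiltration k r :=
  ⟨mem_hodgeFiltration h hX A A', mem_hodgeFiltration h hX A' A⟩

/-- With the fact, `c ∈ Fʳ Hᵏ(X)` (`IsInHodgeFiltration`, `∃` over models) may be tested in ANY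
Hodge model. [cite: VoisinHodgeI2002, §7.1.1] -/
theorem isInHodgeFiltration_iff (h : hodgePQ_independent_of_hodgeModel)
    (hX : Motives.IsSmoothProjective n X) (A : HodgeModel n X) :
    IsInHodgeFiltration n X k r c ↔ A.pullback k c ∈ A.hodgeFiltration k r :=
  ⟨fun ⟨A', hA'⟩ ↦ mem_hodgeFiltration h hX A' A hA', fun hA ↦ ⟨A, hA⟩⟩

/-- With the fact, "`Fʳ Hᵏ(X) ≠ Hᵏ(X)`" in the tree's encoding — some class of `Hᵏ(X(ℂ); ℂ)` lies
in no model's `Fʳ` — is `Fʳ ≠ ⊤` in any one Hodge model (the form in which Voisin II, Rem. 6.26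
states `Fᵖ𝓗^{n-1} ≠ 𝓗^{n-1}`). [cite: VoisinHodgeI2002, §7.1.1] -/
theorem exists_not_isInHodgeFiltration_iff (h : hodgePQ_independent_of_hodgeModel)
    (hX : Motives.IsSmoothProjective n X) (A : HodgeModel n X) (k r : ℕ) :
    (∃ c : Literature.AlgebraicTopology.SingularHomology.singularCohomology ℂ ℂ (Motives.ComplexPoints X) k,
        ¬ IsInHodgeFiltration n X k r c) ↔ A.hodgeFiltration k r ≠ ⊤ := by
  rw [A.hodgeFiltration_ne_top_iff]
  exact exists_congr fun c ↦ not_congr (isInHodgeFiltration_iff h hX A)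

/-- With the fact, `H^{0,k} ≠ 0` in one Hodge model of a smooth projective `X` yields a class of
`Hᵏ(X(ℂ); ℂ)` lying in no model's `Fʳ`, for every `r ≥ 1` (cf. Voisin II, Rem. 6.26).
[cite: VoisinHodgeI2002, §7.1.1] -/
theorem exists_not_isInHodgeFiltration_of_hodgePQ_zero_ne_bot
    (h : hodgePQ_independent_of_hodgeModel) (hX : Motives.IsSmoothProjective n X)
    (A : HodgeModel n X) {k r : ℕ} (hr : 1 ≤ r) (hA : A.hodgePQ k 0 k ≠ ⊥) :
    ∃ c : Literature.AlgebraicTopology.SingularHomology.singularCohomology ℂ ℂ (Motives.ComplexPoints X) k,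
      ¬ IsInHodgeFiltration n X k r c :=
  (exists_not_isInHodgeFiltration_iff h hX A k r).2
    (A.hodgeFiltration_ne_top_of_hodgePQ_zero_ne_bot hr hA)

end hodgePQ_independent_of_hodgeModel

end HodgeTheory

end Literature.AlgebraicGeometry.HodgeTheory

end
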